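import Mathlib
import Summits.QuantumAdvantage.QuantumAdvantage.Theorems.AbsorptionDialB

set_option linter.dupNamespace false

/-!
# AbsorptionDial (C) — the exchange rate, pointwise, and the first open rung (cell decomp-qadv, lens 4, g14 rev 3)

Prop-definition-free continuation of `AbsorptionDialA`/`AbsorptionDialB` (supports of item stmt-QuantumAdvantage-26994 ≡
26767):

* `two_pow_le_losers_of_noPerfect` — **the exchange rate «degree buys losses», pointwise**: if no strategy of cut
  degree `≤ D` on `ℓ ≥ 1` bits wins on every input and `d + 2kd + 1 ≤ D`, then EVERY strategy of cut degree `≤ d` on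
  `k + ℓ` bits loses on at least `2^k` inputs (contrapositive of `perfect_of_few_losses_prefix`);
* `quarter_schedule`, `two_pow_quarter_le_losers_of_sqrtNoPerfect` — **the first open rung of the loss-count ladder**:
  exactness at cut degree `√n` (for large `n`, no strategy of cut degree `≤ ⌊√n⌋` wins everywhere) ⟹ every strategy of
  cut degree `≤ (log₂ n)^C` loses on at least `2^(⌊n^{1/4}⌋)` inputs, for every `C` and large `n` (prefix `k = ⌊n^{1/4}⌋`,
  window `ℓ = n − k`, budget `√ℓ ≥ k² − 1 ≥ (log₂ n)^C (2k+1) + 1` via `log₂ n ≤ 7 log₂ k`).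

0 sorry; axioms standard; no `instance`, no `notation`, no `native_decide`.
-/

open Finset
open Literature.Computability.MetaComplexity Literature.Computability.MetaComplexity.Smolensky
open Summit.QuantumAdvantage.AdviceFreeQNC0

namespace Summit.QuantumAdvantage.QuantumAdvantage.Theorems.AbsorptionDial

variable {p : ℕ} [Fact p.Prime]

/-! ## The exchange rate, pointwise -/

/-- **THE EXCHANGE RATE (pointwise): degree buys losses.**  If NO strategy of cut degree `≤ D` on `ℓ ≥ 1` bits is perfect,
then every strategy of cut degree `≤ d` on `k + ℓ` bits with `d + 2kd + 1 ≤ D` loses on at least `2^k` inputs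
(fewer losses ⟹ a loss-free prefix fibre ⟹ an absorbed perfect strategy of degree `≤ d + 2kd + 1 ≤ D` on `ℓ` bits). -/
theorem two_pow_le_losers_of_noPerfect {k ℓ d D : ℕ} (hℓ : 1 ≤ ℓ)
    (hNP : ∀ (c' : ℕ) (y' : Fin (ℓ + 1) → (Fin ℓ → Bool) → Bool),
      (∀ g, HasDegF p (y' g) D) → ∃ w, ringWinU c' y' w = false)
    (hsched : d + (2 * (k * d) + 1) ≤ D) (c : ℕ) (y : Fin (k + ℓ + 1) → (Fin (k + ℓ) → Bool) → Bool)
    (hy : ∀ g, HasDegF p (y g) d) :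
    2 ^ k ≤ (univ.filter fun u : Fin (k + ℓ) → Bool => ringWinU c y u = false).card := by
  by_contra hlt
  rw [not_le] at hlt
  obtain ⟨c', y', hy', hperf⟩ := perfect_of_few_losses_prefix (k := k) (ℓ := ℓ) hℓ c y hy hlt
  have hdeg : ∀ g, HasDegF p (y' g) D := fun g => by
    have h := hy' g
    unfold HasDegF at h ⊢
    exact lowDeg_mono hsched h
  obtain ⟨w, hw⟩ := hNP c' y' hdeg
  rw [hperf w] at hw
  exact Bool.noConfusion hw


/-! ## The first open rung: exactness at degree `√n` buys `2^(n^{1/4})` losses -/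

/-- growth: `(7·log₂ r)^C · (2r+1) + 2 ≤ r²` for large `r`. -/
theorem quarter_schedule (C : ℕ) : ∃ r₀ : ℕ, ∀ r ≥ r₀, (7 * Nat.log 2 r) ^ C * (2 * r + 1) + 2 ≤ r ^ 2 := by
  obtain ⟨L₀, hL₀⟩ := const_mul_pow_le_two_pow (3 * 7 ^ C + 2) C
  refine ⟨2 ^ (max L₀ 1), fun r hr => ?_⟩
  have hr0 : r ≠ 0 := by have := Nat.one_le_two_pow (n := max L₀ 1); omega
  have hr1 : 1 ≤ r := Nat.one_le_iff_ne_zero.mpr hr0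
  set L := Nat.log 2 r with hL
  have hLge : max L₀ 1 ≤ L := Nat.le_log_of_pow_le one_lt_two hr
  have hL1 : 1 ≤ L := le_trans (le_max_right _ _) hLge
  have h2L : 2 ^ L ≤ r := Nat.pow_log_le_self 2 hr0
  have hmain : (3 * 7 ^ C + 2) * L ^ C ≤ r := (hL₀ L (le_trans (le_max_left _ _) hLge)).trans h2L
  have hLC : 1 ≤ L ^ C := Nat.one_le_pow _ _ hL1
  calc (7 * L) ^ C * (2 * r + 1) + 2
      ≤ (7 * L) ^ C * (3 * r) + 2 * r := by
        have : (7 * L) ^ C * (2 * r + 1) ≤ (7 * L) ^ C * (3 * r) := Nat.mul_le_mul_left _ (by omega)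
        omega
    _ = (3 * 7 ^ C * L ^ C + 2) * r := by rw [mul_pow]; ring
    _ ≤ ((3 * 7 ^ C + 2) * L ^ C) * r := by
        apply Nat.mul_le_mul_right
        nlinarith
    _ ≤ r * r := Nat.mul_le_mul_right _ hmain
    _ = r ^ 2 := (sq r).symm

/-- **degree `√n` exactness ⟹ `2^(n^{1/4})` losses (hypothesis spelled out).**  If for `m ≥ n₁` no strategy of cut
degree `≤ √m` on `m` bits wins on every input, then for every `C`, for large `n`, every strategy of cut degree
`≤ (log₂ n)^C` loses on at least `2^(⌊n^{1/4}⌋)` inputs — the exchange rate `two_pow_le_losers_of_noPerfect` with prefix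
`k = n^{1/4}`, window `ℓ = n − k` and budget `√ℓ ≥ k² − 1 ≥ (log₂ n)^C (2k+1) + 1`. -/
theorem two_pow_quarter_le_losers_of_sqrtNoPerfect (n₁ : ℕ)
    (hn₁ : ∀ m ≥ n₁, ∀ (c' : ℕ) (y' : Fin (m + 1) → (Fin m → Bool) → Bool),
      (∀ g, HasDegF p (y' g) (Nat.sqrt m)) → ∃ w, ringWinU c' y' w = false)
    (C : ℕ) : ∃ n₀ : ℕ, ∀ n ≥ n₀, ∀ c : ℕ, ∀ y : Fin (n + 1) → (Fin n → Bool) → Bool,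
      (∀ g, HasDegF p (y g) ((Nat.log 2 n) ^ C)) →
        2 ^ (Nat.sqrt (Nat.sqrt n)) ≤ (univ.filter fun u : Fin n → Bool => ringWinU c y u = false).card := by
  obtain ⟨r₀, hr₀⟩ := quarter_schedule C
  refine ⟨max ((max r₀ 2) ^ 4) (2 * n₁ + 2), fun n hn c y hy => ?_⟩
  show 2 ^ (Nat.sqrt (Nat.sqrt n)) ≤ _
  obtain ⟨r, hr⟩ : ∃ r, r = Nat.sqrt (Nat.sqrt n) := ⟨_, rfl⟩
  rw [← hr]
  have hn4 : (max r₀ 2) ^ 4 ≤ n := le_trans (le_max_left _ _) hn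
  have hn2 : 2 * n₁ + 2 ≤ n := le_trans (le_max_right _ _) hn
  -- `r ≥ max r₀ 2`
  have hrge : max r₀ 2 ≤ r := by
    rw [hr, Nat.le_sqrt', Nat.le_sqrt', ← pow_mul]
    exact hn4
  have hr2 : 2 ≤ r := le_trans (le_max_right _ _) hrge
  have hrr₀ : r₀ ≤ r := le_trans (le_max_left _ _) hrge
  -- `(r²)² ≤ n < (r+1)^4`
  have hr2n : r ^ 2 ≤ Nat.sqrt n := Nat.le_sqrt'.1 (le_of_eq hr)
  have hr4n : (r ^ 2) ^ 2 ≤ n := Nat.le_sqrt'.1 hr2n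
  have hnlt : n < ((r + 1) ^ 2) ^ 2 := by
    have h1 : Nat.sqrt n < (r + 1) ^ 2 := hr ▸ Nat.lt_succ_sqrt' (Nat.sqrt n)
    have h2 : n < (Nat.sqrt n + 1) ^ 2 := Nat.lt_succ_sqrt' n
    exact lt_of_lt_of_le h2 (Nat.pow_le_pow_left h1 2)
  -- `log₂ n ≤ 7 · log₂ r`
  set L := Nat.log 2 r with hL
  have hL1 : 1 ≤ L := Nat.le_log_of_pow_le one_lt_two (by simpa using hr2)
  have hrlt : r < 2 ^ (L + 1) := Nat.lt_pow_succ_log_self one_lt_two r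
  have hn0 : n ≠ 0 := by omega
  have hlogn : Nat.log 2 n ≤ 7 * L := by
    have h0 : (r + 1) ^ 2 ≤ (2 ^ (L + 1)) ^ 2 := Nat.pow_le_pow_left (by omega) 2
    have h1 : ((r + 1) ^ 2) ^ 2 ≤ 2 ^ ((L + 1) * 4) :=
      calc ((r + 1) ^ 2) ^ 2 ≤ ((2 ^ (L + 1)) ^ 2) ^ 2 := Nat.pow_le_pow_left h0 2
        _ = 2 ^ ((L + 1) * 4) := by ring
    have h3 := Nat.log_lt_of_lt_pow hn0 (lt_of_lt_of_le hnlt h1)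
    omega
  -- split `n = r + ℓ`
  have hrn : 2 * r ≤ n := by nlinarith
  obtain ⟨ℓ, rfl⟩ : ∃ ℓ, n = r + ℓ := ⟨n - r, by omega⟩
  have hℓ1 : 1 ≤ ℓ := by omega
  have hℓn₁ : n₁ ≤ ℓ := by omega
  -- the schedule: `d(2r+1) + 1 ≤ r² − 1 ≤ √ℓ`
  -- `s + 1 = r²`, `s ≤ √ℓ`
  obtain ⟨s, hs⟩ : ∃ s, r ^ 2 = s + 1 := ⟨r ^ 2 - 1, by
    have : 1 ≤ r ^ 2 := Nat.one_le_pow _ _ (by omega); omega⟩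
  have hsq : s ≤ Nat.sqrt ℓ := by
    rw [Nat.le_sqrt']
    have h1 : (s + 1) ^ 2 ≤ r + ℓ := hs ▸ hr4n
    have h2 : r ≤ s + 1 := by nlinarith
    nlinarith
  have hd : (Nat.log 2 (r + ℓ)) ^ C ≤ (7 * L) ^ C := Nat.pow_le_pow_left hlogn C
  have hsched : (Nat.log 2 (r + ℓ)) ^ C + (2 * (r * (Nat.log 2 (r + ℓ)) ^ C) + 1) ≤ Nat.sqrt ℓ := by
    have h1 : (7 * L) ^ C * (2 * r + 1) + 2 ≤ s + 1 := hs ▸ hL ▸ hr₀ r hrr₀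
    have h2 : (Nat.log 2 (r + ℓ)) ^ C + (2 * (r * (Nat.log 2 (r + ℓ)) ^ C) + 1)
        = (Nat.log 2 (r + ℓ)) ^ C * (2 * r + 1) + 1 := by ring
    rw [h2]
    have h3 : (Nat.log 2 (r + ℓ)) ^ C * (2 * r + 1) ≤ (7 * L) ^ C * (2 * r + 1) :=
      Nat.mul_le_mul_right _ hd
    omega
  exact two_pow_le_losers_of_noPerfect hℓ1 (hn₁ ℓ hℓn₁) hsched c y hy


end Summit.QuantumAdvantage.QuantumAdvantage.Theorems.AbsorptionDial
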